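import Summits.PneNP.PneNP.Theorems.SymmetryBudgetWindowCanoniserSemCell

/-!
# Window canoniser, XV: gate semantics of the replay — the refinement rounds

Route `PneNP/SymmetryBudget`, dichotomy `WindowBarrier` (stmt-PneNP-2145) / `NoHiddenOrder` (stmt-PneNP-14781);
continuation of `…WindowCanoniserSemCell.lean`.  Under `WCan.Corr L x it S`: the refinement gates of iteration
`it` run the tree's ORDERED COLOUR REFINEMENT (`Literature.Combinatorics.SimpleGraph.ocrIter`) on the state graph
`CGCanon.within (G x) W` from the lifted colouring of `WCan.indCol` (the state colouring with the selected vertex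
individualised): **`fLT it rd u w ↔ ocrIter … rd u < ocrIter … rd w`** (`WCan.ev_aFLT`), so that after `n`
rounds the gates hold the order of `CGCanon.crRefine (G x) W (indCol L S)`.  Round `0` reads the individualised
lifted order (`iLTW`); a round is the counting form of one `ocrStep` (`fcge` compares neighbour counts into a
colour class by one majority gate, `fallb`/`flex` assemble `ProfLT`, `KeyLT`), as in the tree's `SymCR`.
-/

-- `Summit.PneNP.PneNP.…` duplicates `PneNP` BY DESIGN (single-problem summit, D-0017 layout).
set_option linter.dupNamespace false

noncomputable section

namespace Summit.PneNP.PneNP.Theorems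

namespace WCan

open Finset Literature.Computability.Complexity Literature.Computability.Complexity.CGCanon
  Literature.Computability.Complexity.ColourRefinementScheme Literature.Combinatorics.SimpleGraph
open scoped Classical

variable {K r n : ℕ} [NeZero n] {L : Lab K n} {x : Fin (r + n) × Fin (r + n) → Bool} {it : Fin (T n + 1)} {S : St n}

/-- The colouring refined at iteration `it`: the lifted individualised colouring. -/
abbrev col0 (L : RawLab n) (S : St n) : Fin n → ℕ := liftCol S.W (indCol L S)

/-- The colouring after `rd` rounds. -/
abbrev colR (L : RawLab n) (x : Fin (r + n) × Fin (r + n) → Bool) (S : St n) (rd : ℕ) : Fin n → ℕ :=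
  ocrIter (within (G x) S.W) (col0 L S) rd

variable (h : Corr L x it S) (hn : 2 ≤ n)
include h hn

/-! ### Round `0`: the individualised lifted order -/

/-- The round-`0` wire reads the order of `col0`. -/
theorem wire_iLTW (u w : Fin n) : GateDAG.wire x (Vl K x) (iLTW (r := r) L it u w) = true ↔ col0 L.1 S u < col0 L.1 S w := by
  unfold iLTW
  by_cases huw : u = w
  · subst huw; simp
  rw [if_neg huw, wire_w2, Vl_n2or x _ (by simp)]
  simp only [List.mem_cons, List.not_mem_nil, or_false, exists_eq_or_imp, exists_eq_left]
  rw [Vl_n1and x _ (by simp), Vl_n1and x _ (by simp), Vl_n1and x _ (by simp)]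
  simp only [List.mem_cons, List.not_mem_nil, or_false, forall_eq_or_imp, forall_eq, holds_pos, holds_neg, h.W, h.LT,
    ev_aSel h hn, decide_eq_true_eq, decide_eq_false_iff_not]
  unfold col0
  rcases (selSet L.1 S).eq_empty_or_nonempty with h0 | ⟨v, hv⟩
  · -- nothing selected: the lifted order of `c`
    rw [indCol_of_empty L.1 h0, ← S.liftLT_iff]
    simp only [h0, Finset.notMem_empty, and_false, false_or, not_false_eq_true, and_true, St.liftLT]
    tauto
  · have hvW : v ∈ S.W := (mem_bigMinCell.1 ((mem_selSet L.1).1 hv).1).1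
    rw [indCol_of_mem L.1 hv, selSet_eq_singleton L.1 hv]
    simp only [mem_singleton, St.liftLT, liftCol, individualize]
    by_cases hu : u ∈ S.W <;> by_cases hw : w ∈ S.W <;> by_cases huv : u = v <;> by_cases hwv : w = v <;>
      simp [hu, hw, huv, hwv, hvW] <;> omega

/-- **Round `0`**: `fLT it 0 u w` reads the order of `col0`. -/
theorem ev_aFLT_zero (u w : Fin n) : ev x (aFLT (r := r) L it 0 u w) = decide (colR L.1 x S 0 u < colR L.1 x S 0 w) := by
  apply Bool.eq_iff_iff.2
  show Vl K x _ = true ↔ _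
  rw [Vl_eq, decide_eq_true_iff]
  show (GateFn.and 1).2 (fun i => GateDAG.wire x (Vl K x) (Kind.argsR L .fLT (prm (vec2 u w) (it := it) (rd := 0)) i)) = true ↔ _
  simp only [GateFn.and, decide_eq_true_iff, Kind.argsR, prm_it, prm_vs, prm_rd, vec2_0, vec2_1, Fin.forall_fin_one]
  exact wire_iLTW h hn u w

/-! ### One round -/

section Round

variable {rd : Fin (n + 1)} (hrd : (rd : ℕ) < n)
  (hLT : ∀ a b, ev x (aFLT (r := r) L it rd a b) = decide (colR L.1 x S rd a < colR L.1 x S rd b))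
include hLT

omit h hn in
/-- Equal colours at round `rd`, from the strict-order gates. -/
theorem colR_eq_iff (a b : Fin n) : (ev x (aFLT (r := r) L it rd a b) = false ∧ ev x (aFLT (r := r) L it rd b a) = false) ↔ (colR L.1 x S rd) a = (colR L.1 x S rd) b := by
  have h1 := hLT a b; have h2 := hLT b a
  constructor
  · rintro ⟨ha, hb⟩
    rw [ha] at h1; rw [hb] at h2
    have := (decide_eq_false_iff_not).1 h1.symm
    have := (decide_eq_false_iff_not).1 h2.symm
    omega
  · intro he
    constructor
    · rw [h1]; exact decide_eq_false (by omega)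
    · rw [h2]; exact decide_eq_false (by omega)

omit hn in
/-- The "adjacent, in the class of `w`" block wire. -/
theorem wire_fae (u w' w : Fin n) :
    GateDAG.wire x (Vl K x) (w1 (n1and [pos (aW L it u), pos (aW L it w'), adjLit u w', neg (aFLT (r := r) L it rd w' w),
      neg (aFLT (r := r) L it rd w w')])) = true ↔ ((within (G x) S.W).Adj u w' ∧ (colR L.1 x S rd) w' = (colR L.1 x S rd) w) := by
  rw [wire_w1, Vl_n1and x _ (by simp)]
  simp only [List.mem_cons, List.not_mem_nil, or_false, forall_eq_or_imp, forall_eq, holds_pos, holds_neg, h.W,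
    decide_eq_true_eq, holds_adjLit, within_adj, ← colR_eq_iff hLT w' w]
  tauto

omit hn in
/-- Its negated companion. -/
theorem wire_fnae (v w' w : Fin n) :
    GateDAG.wire x (Vl K x) (w1 (n1or [neg (aW L it v), neg (aW L it w'), nadjLit v w', pos (aFLT (r := r) L it rd w' w),
      pos (aFLT (r := r) L it rd w w')])) = true ↔ ¬ ((within (G x) S.W).Adj v w' ∧ (colR L.1 x S rd) w' = (colR L.1 x S rd) w) := by
  rw [wire_w1, Vl_n1or x _ (by simp), ← colR_eq_iff hLT w' w]
  simp only [List.mem_cons, List.not_mem_nil, or_false, exists_eq_or_imp, exists_eq_left, holds_pos, holds_neg, h.W,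
    decide_eq_false_iff_not, holds_nadjLit, within_adj]
  cases ev x (aFLT (r := r) L it rd w' w) <;> cases ev x (aFLT (r := r) L it rd w w')
  all_goals simp
  all_goals tauto

omit hn in
/-- **The counting gadget**: `fcge it rd u v w` fires iff `v` has at most as many neighbours of the colour of `w` as `u`. -/
theorem ev_aFcge (u v w : Fin n) : ev x (aFcge (r := r) L it rd u v w) = true ↔
    nbrCount (within (G x) S.W) (colR L.1 x S rd) v ((colR L.1 x S rd) w) ≤ nbrCount (within (G x) S.W) (colR L.1 x S rd) u ((colR L.1 x S rd) w) := by
  show Vl K x _ = true ↔ _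
  rw [Vl_eq]
  show decide (n + n ≤ 2 * GateFn.numOnes (fun i : Fin (n + n) => GateDAG.wire x (Vl K x)
    (Kind.argsR L .fcge (prm (vec3 u v w) (it := it) (rd := rd)) i))) = true ↔ _
  rw [decide_eq_true_iff]
  simp only [Kind.argsR, prm_it, prm_vs, prm_rd, vec3_0, vec3_1, vec3_2]
  have happ : (fun i : Fin (n + n) => GateDAG.wire x (Vl K x) (Fin.append
      (fun w' => w1 (n1and [pos (aW L it u), pos (aW L it w'), adjLit u w', neg (aFLT L it rd w' w), neg (aFLT L it rd w w')]))
      (fun w' => w1 (n1or [neg (aW L it v), neg (aW L it w'), nadjLit v w', pos (aFLT L it rd w' w), pos (aFLT L it rd w w')])) i)) =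
      Fin.append (fun w' => decide ((within (G x) S.W).Adj u w' ∧ (colR L.1 x S rd) w' = (colR L.1 x S rd) w))
        (fun w' => decide (¬ ((within (G x) S.W).Adj v w' ∧ (colR L.1 x S rd) w' = (colR L.1 x S rd) w))) := by
    funext i
    induction i using Fin.addCases with
    | left i => rw [Fin.append_left, Fin.append_left]; exact Bool.eq_iff_iff.2 (by rw [wire_fae h hLT, decide_eq_true_iff])
    | right j => rw [Fin.append_right, Fin.append_right]; exact Bool.eq_iff_iff.2 (by rw [wire_fnae h hLT, decide_eq_true_iff])
  rw [happ, Literature.Computability.AlgebraicComplexity.LabelledArithCircuit.numOnes_append, numOnes_eq_card, numOnes_eq_card]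
  have hA : (univ.filter fun w' => decide ((within (G x) S.W).Adj u w' ∧ (colR L.1 x S rd) w' = (colR L.1 x S rd) w) = true).card = nbrCount (within (G x) S.W) (colR L.1 x S rd) u ((colR L.1 x S rd) w) := by
    unfold nbrCount; congr 1; ext w'; simp
  have hB : (univ.filter fun w' => decide (¬ ((within (G x) S.W).Adj v w' ∧ (colR L.1 x S rd) w' = (colR L.1 x S rd) w)) = true).card = n - nbrCount (within (G x) S.W) (colR L.1 x S rd) v ((colR L.1 x S rd) w) := by
    have : (univ.filter fun w' => decide (¬ ((within (G x) S.W).Adj v w' ∧ (colR L.1 x S rd) w' = (colR L.1 x S rd) w)) = true) =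
        univ \ univ.filter fun w' => (within (G x) S.W).Adj v w' ∧ (colR L.1 x S rd) w' = (colR L.1 x S rd) w := by
      ext w'; simp only [mem_filter, mem_univ, true_and, decide_eq_true_eq, mem_sdiff]
    rw [this, card_univ_sdiff, Fintype.card_fin]
    unfold nbrCount; congr 2
  rw [hA, hB]
  have : nbrCount (within (G x) S.W) (colR L.1 x S rd) v ((colR L.1 x S rd) w) ≤ n := (card_filter_le _ _).trans_eq (by simp)
  omega

omit hn in
/-- `fallb it rd u v w`: `u` and `v` have equally many neighbours of every colour below the colour of `w`. -/
theorem ev_aFallb (u v w : Fin n) : ev x (aFallb (r := r) L it rd u v w) = true ↔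
    ∀ w', (colR L.1 x S rd) w' < (colR L.1 x S rd) w → nbrCount (within (G x) S.W) (colR L.1 x S rd) u ((colR L.1 x S rd) w') = nbrCount (within (G x) S.W) (colR L.1 x S rd) v ((colR L.1 x S rd) w') := by
  show Vl K x _ = true ↔ _
  rw [Vl_eq]
  show (GateFn.and n).2 (fun i => GateDAG.wire x (Vl K x) (Kind.argsR L .fallb (prm (vec3 u v w) (it := it) (rd := rd)) i)) = true ↔ _
  simp only [GateFn.and, decide_eq_true_iff, Kind.argsR, prm_it, prm_vs, prm_rd, vec3_0, vec3_1, vec3_2, wire_w2]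
  have hw : ∀ w' : Fin n, Vl K x (.f2 (n2or [litN1 (neg (aFLT L it rd w' w)), n1and [pos (aFcge L it rd u v w'), pos (aFcge L it rd v u w')]])) = true ↔
      ((colR L.1 x S rd) w' < (colR L.1 x S rd) w → nbrCount (within (G x) S.W) (colR L.1 x S rd) u ((colR L.1 x S rd) w') = nbrCount (within (G x) S.W) (colR L.1 x S rd) v ((colR L.1 x S rd) w')) := by
    intro w'
    rw [Vl_n2or x _ (by simp)]
    simp only [List.mem_cons, List.not_mem_nil, or_false, exists_eq_or_imp, exists_eq_left, Vl_litN1, holds_neg, hLT,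
      decide_eq_false_iff_not]
    rw [Vl_n1and x _ (by simp)]
    simp only [List.mem_cons, List.not_mem_nil, or_false, forall_eq_or_imp, forall_eq, holds_pos, ev_aFcge h hLT]
    constructor
    · rintro (h1 | ⟨h1, h2⟩) hlt
      · exact absurd hlt h1
      · exact le_antisymm h2 h1
    · intro himp
      by_cases hlt : (colR L.1 x S rd) w' < (colR L.1 x S rd) w
      · exact Or.inr ⟨(himp hlt).ge, (himp hlt).le⟩
      · exact Or.inl hlt
  simp only [hw]

omit hn in
/-- `flex it rd u v`: the lexicographic clause `ProfLT`. -/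
theorem ev_aFlex (u v : Fin n) : ev x (aFlex (r := r) L it rd u v) = true ↔ ProfLT (within (G x) S.W) (colR L.1 x S rd) u v := by
  show Vl K x _ = true ↔ _
  rw [Vl_eq]
  show (GateFn.or n).2 (fun i => GateDAG.wire x (Vl K x) (Kind.argsR L .flex (prm (vec2 u v) (it := it) (rd := rd)) i)) = true ↔ _
  simp only [GateFn.or, decide_eq_true_iff, Kind.argsR, prm_it, prm_vs, prm_rd, vec2_0, vec2_1, wire_w1]
  have hw : ∀ w : Fin n, Vl K x (.f1 (n1and [neg (aFcge L it rd u v w), pos (aFallb L it rd u v w)])) = true ↔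
      (nbrCount (within (G x) S.W) (colR L.1 x S rd) u ((colR L.1 x S rd) w) < nbrCount (within (G x) S.W) (colR L.1 x S rd) v ((colR L.1 x S rd) w) ∧
        ∀ w', (colR L.1 x S rd) w' < (colR L.1 x S rd) w → nbrCount (within (G x) S.W) (colR L.1 x S rd) u ((colR L.1 x S rd) w') = nbrCount (within (G x) S.W) (colR L.1 x S rd) v ((colR L.1 x S rd) w')) := by
    intro w
    rw [Vl_n1and x _ (by simp)]
    simp only [List.mem_cons, List.not_mem_nil, or_false, forall_eq_or_imp, forall_eq, holds_pos, holds_neg, ev_aFallb h hLT,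
      and_congr_left_iff]
    intro _
    rw [← not_le]
    have := ev_aFcge h hLT u v w
    cases hh : ev x (aFcge (r := r) L it rd u v w)
    · rw [hh] at this; simp only [Bool.false_eq_true, false_iff] at this; simp [this]
    · rw [hh] at this; simp only [true_iff] at this; simp [this]
  simp only [hw, ProfLT]

omit hn in
/-- **The step**: `fLT it (rd+1) u w` reads the order of the next round. -/
theorem ev_aFLT_succ (u w : Fin n) : ev x (aFLT (r := r) L it ⟨rd + 1, by omega⟩ u w) =
    decide (colR L.1 x S (rd + 1) u < colR L.1 x S (rd + 1) w) := by
  apply Bool.eq_iff_iff.2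
  show Vl K x _ = true ↔ _
  rw [Vl_eq, decide_eq_true_iff]
  show (GateFn.and 1).2 (fun i => GateDAG.wire x (Vl K x) (Kind.argsR L .fLT (prm (vec2 u w) (it := it) (rd := ⟨rd + 1, by omega⟩)) i)) = true ↔ _
  simp only [GateFn.and, decide_eq_true_iff, Kind.argsR, prm_it, prm_vs, prm_rd, vec2_0, vec2_1, Fin.forall_fin_one, wire_w2]
  rw [Vl_n2or x _ (by simp)]
  simp only [List.mem_cons, List.not_mem_nil, or_false, exists_eq_or_imp, exists_eq_left, Vl_litN1, holds_pos, Fin.eta, hLT,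
    decide_eq_true_eq]
  rw [Vl_n1and x _ (by simp)]
  simp only [List.mem_cons, List.not_mem_nil, or_false, forall_eq_or_imp, forall_eq, holds_pos, holds_neg,
    ev_aFlex h hLT]
  rw [show (ev x (aFLT L it rd u w) = false ∧ ev x (aFLT L it rd w u) = false ∧ ProfLT (within (G x) S.W) (colR L.1 x S rd) u w) ↔
    ((ev x (aFLT L it rd u w) = false ∧ ev x (aFLT L it rd w u) = false) ∧ ProfLT (within (G x) S.W) (colR L.1 x S rd) u w) from and_assoc.symm,
    colR_eq_iff hLT]
  show _ ↔ ocrIter (within (G x) S.W) (col0 L.1 S) (rd + 1) u < ocrIter (within (G x) S.W) (col0 L.1 S) (rd + 1) w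
  rw [ocrIter_succ, ocrStep_lt_iff]
  rfl

end Round

/-- **The refinement gates compute ordered colour refinement**: `fLT it rd u w ↔ ocrIter … rd u < ocrIter … rd w`. -/
theorem ev_aFLT (rd : Fin (n + 1)) (u w : Fin n) : ev x (aFLT (r := r) L it rd u w) = decide (colR L.1 x S rd u < colR L.1 x S rd w) := by
  obtain ⟨rv, hrv⟩ := rd
  induction rv generalizing u w with
  | zero => exact ev_aFLT_zero h hn u w
  | succ rv ih => exact ev_aFLT_succ h (rd := ⟨rv, by omega⟩) (by simp; omega) (fun a b => ih a b (by omega)) u w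

/-- **After `n` rounds the gates hold the order of `CGCanon.crRefine (G x) W (indCol L S)`.** -/
theorem ev_aFLT_last (u w : Fin n) : ev x (aFLT (r := r) L it (Fin.last n) u w) =
    decide (crRefine (G x) S.W (indCol L.1 S) u < crRefine (G x) S.W (indCol L.1 S) w) :=
  ev_aFLT h hn (Fin.last n) u w

end WCan

end Summit.PneNP.PneNP.Theorems

end
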